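import Summits.MatrixMultiplication.OmegaCensus.DihedralLikeModel
import Summits.MatrixMultiplication.OmegaCensus.DihedralLikeLawGap
import HarnessLib

/-!
# The complete law for `ℤ_n ⋊ ℤ₄ = G(ℤ₂ × ℤ_n, (1,0))`: `β = 8⌊2n/3⌋` for every `n ≥ 7`

ω-census, family (b3).  Framing: lottery ticket; floor = certified bounds/negative ranges.

`DihedralLikeModel.lean` gave `β(G(ℤ₂ × ℤ_n, (ε,0))) = 4⌊4n/3⌋ = 8⌊2n/3⌋` for `n ≢ 1 (mod 3)` and the window
`[8⌊2n/3⌋, 8⌊2n/3⌋ + 2]` for even `n ≡ 1 (mod 3)`.  For `ε = 1` the window closes at its bottom for EVERY `n ≡ 1 (mod 3)`,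
`n ≥ 7`: `|A| = 2n ≡ 2 (mod 3)` is even and `c₀ = (1,0) ≠ 0`, so `tpp_volume_le_law_sub_four_of_not_dihedral`
(`DihedralLikeLawGap.lean`: among the dihedral-like groups of order `2|A|` only `D_{2|A|}` attains the slack-4 law, all others
have `3V + 16 ≤ 8|A|`) gives `β ≤ 8⌊2n/3⌋`, attained by the lifted dihedral family (`z2zn_volume_ge_law`).  Hence

**`semidirect_z4_law_complete`: `β(ℤ_n ⋊ ℤ₄) = 8⌊2n/3⌋ = 2·β(D_{2n})` for every `n ≥ 7`** — the same value as the
dicyclic group `Q_{4n}` of the same order (`dicyclic_law_complete`; for odd `n` the two groups coincide), versus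
`β(D_{4n}) = 4⌊4n/3⌋` and `β(C₂ × D_{2n}) ∈ {4⌊4n/3⌋, 8⌊2n/3⌋}` (`c2_dihedral_law_even` …).
-/

namespace Summit.MatrixMultiplication.OmegaCensus

open Literature.Combinatorics.Additive Finset

section Z4

variable {n : ℕ} [NeZero n]

/-- **`n ≡ 1 (mod 3)`, `n ≥ 7`: `β(ℤ_n ⋊ ℤ₄) = 8⌊2n/3⌋`** (upper bound `3V + 16 ≤ 16n` from
`tpp_volume_le_law_sub_four_of_not_dihedral` with `c₀ = (1,0) ≠ 0`; attained by the lifted dihedral family). [folklore] -/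
theorem semidirect_z4_law_mod_one (hmod : n % 3 = 1) (hn : 7 ≤ n) :
    (∀ S T U : Finset (DihedralLikeGroup (ZMod 2 × ZMod n) ((1 : ZMod 2), 0)), TripleProductProperty S T U →
        S.card * T.card * U.card ≤ 8 * (2 * n / 3)) ∧
    ∃ S T U : Finset (DihedralLikeGroup (ZMod 2 × ZMod n) ((1 : ZMod 2), 0)), TripleProductProperty S T U ∧
      S.card * T.card * U.card = 8 * (2 * n / 3) := by
  refine ⟨fun S T U h => ?_, z2zn_volume_ge_law (ε := 1) (by omega)⟩
  have hc : (((1 : ZMod 2), (0 : ZMod n)) : ZMod 2 × ZMod n) ≠ 0 := fun h0 => by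
    have h1 : (1 : ZMod 2) = 0 := congrArg Prod.fst h0
    exact absurd h1 (by decide)
  have key := tpp_volume_le_law_sub_four_of_not_dihedral (A := ZMod 2 × ZMod n)
    (ρ := (DihedralLikeGroup.rho : ZMod 2 × ZMod n → DihedralLikeGroup (ZMod 2 × ZMod n) ((1 : ZMod 2), 0)))
    (τ := DihedralLikeGroup.tau) (c₀ := ((1 : ZMod 2), (0 : ZMod n))) DihedralLikeGroup.rho_mul_rho
    DihedralLikeGroup.rho_mul_tau DihedralLikeGroup.tau_mul_rho DihedralLikeGroup.tau_mul_tau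
    DihedralLikeGroup.rho_injective DihedralLikeGroup.tau_injective DihedralLikeGroup.rho_ne_tau
    DihedralLikeGroup.rho_or_tau
    (by rw [Fintype.card_prod, ZMod.card, ZMod.card]; omega)
    (by rw [Fintype.card_prod, ZMod.card, ZMod.card]; omega)
    (by rw [Fintype.card_prod, ZMod.card, ZMod.card]; omega) (Or.inr hc) h
  rw [Fintype.card_prod, ZMod.card, ZMod.card] at key
  omega

/-- **The complete law: `β(ℤ_n ⋊ ℤ₄) = 8⌊2n/3⌋` for every `n ≥ 7`** (`n ≢ 1 (mod 3)`: `z2zn_law`, where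
`4⌊4n/3⌋ = 8⌊2n/3⌋`; `n ≡ 1 (mod 3)`: `semidirect_z4_law_mod_one`).  Equal to `β(Q_{4n})` and to `2β(D_{2n})`. [folklore] -/
theorem semidirect_z4_law_complete (hn : 7 ≤ n) :
    (∀ S T U : Finset (DihedralLikeGroup (ZMod 2 × ZMod n) ((1 : ZMod 2), 0)), TripleProductProperty S T U →
        S.card * T.card * U.card ≤ 8 * (2 * n / 3)) ∧
    ∃ S T U : Finset (DihedralLikeGroup (ZMod 2 × ZMod n) ((1 : ZMod 2), 0)), TripleProductProperty S T U ∧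
      S.card * T.card * U.card = 8 * (2 * n / 3) := by
  by_cases hmod : n % 3 = 1
  · exact semidirect_z4_law_mod_one hmod hn
  · obtain ⟨hup, S, T, U, h, hvol⟩ := z2zn_law (n := n) (ε := 1) (by omega) hmod
    refine ⟨fun S T U h => ?_, S, T, U, h, by omega⟩
    have := hup S T U h
    omega

end Z4

end Summit.MatrixMultiplication.OmegaCensus
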